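import Literature.NumberTheory.LFunctions.MertensFormula
import Literature.NumberTheory.LFunctions.PrimeNumberTheoremErrorTermProofs
import HarnessLib

/-!
# Mertens' first and second theorems with prime-number-theorem-strength error terms

Topic `Literature/NumberTheory/LFunctions` (trunk T-ANT), continuing `MertensConstant.lean` /
`MertensFormula.lean` (which PROVE `∑_{p ≤ x} 1/p = log log x + B₁ + O(1/log x)` by partial
summation from the bounded quantity `τ(x) = ∑_{p ≤ x} log p/p - log x`). Everything in this file is
PROVED (no named facts, no `sorry`):

* `mertensTau_eq` — partial summation from `ϑ`:
  `τ(x) = 1 - log 2 + (ϑ(x) - x)/x + ∫_2^x (ϑ(t) - t) dt/t²` (`x ≥ 2`);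
* `abs_mertensTau_sub_const_le` — **Mertens' first theorem with its constant and a log-power
  error**: for every `n`, `|τ(x) - E| ≤ K_n/(log x)^n` (`x ≥ 2`), where
  `E = 1 - log 2 + ∫_2^∞ (ϑ(t) - t) dt/t²` (`E`; classically `E = -γ - ∑_p log p/(p(p-1))`,
  an identification not needed here), from the tree's PROVED prime number theorem with the
  de la Vallée Poussin error term in the form `|ϑ(x) - x| ≤ C_A x/(log x)^A`
  (`Literature.NumberTheory.LFunctions.ChebyshevThetaDeLaValleePoussin_holds.logPow`);
* `abs_primeRecipSum_sub_loglog_sub_le` — **Mertens' second theorem with a log-power error**: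
  for every `n`, `|∑_{p ≤ x} 1/p - log log x - B₁| ≤ K_n/(log x)^n` (`x ≥ 2`), `B₁` the
  Meissel–Mertens constant (`meisselMertens`), via the exact formula
  `∑_{p≤x} 1/p - log log x - B₁ = (τ(x) - E)/log x - ∫_x^∞ (τ(t) - E) dt/(t log² t)`;
* `exists_sum_primesLE_inv_loglog` — the same in the shape of hypothesis (1.9) of
  Friedlander–Iwaniec, *Asymptotic sieve for primes*, for the density `f(p) = 1/p`:
  `∑_{p ≤ y} 1/p = log log y + c + O((log y)^{-10})` (the input "`f` is another multiplicative
  function which satisfies the hypothesis (1.9)" of FI p. 1049, proof of (2.4)).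

These are the classical consequences of the prime number theorem with error term recorded in
Montgomery–Vaughan, *Multiplicative Number Theory I*, §6.2 (Exercise 6.2.1 / the remark after
Theorem 6.9: (2.14)–(2.16) of their Theorem 2.7 hold with error `O(exp(-c√log x))`); we only
need, and only prove, the log-power form.

## References

* H. L. Montgomery, R. C. Vaughan, *Multiplicative Number Theory I. Classical Theory*, CUP 2007,
  Thm 2.7 (b), (d) and §6.2 (Thm 6.9 and the remarks following it). [MontgomeryVaughan2007]
* G. H. Hardy, E. M. Wright, *An Introduction to the Theory of Numbers*, 6th ed., §22.7
  (eq. (22.7.3)). [HardyWright2008]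
* J. Friedlander, H. Iwaniec, *Asymptotic sieve for primes*, Ann. of Math. 148 (1998), (1.9) and
  p. 1049. [FriedlanderIwaniecASP1998]
-/

noncomputable section

open Filter Topology Set MeasureTheory Finset Real
open scoped Chebyshev

namespace Literature.NumberTheory.LFunctions.Mertens

/-! ### The weights `∫_x^∞ dt/(t (log t)^{n+2}) = 1/((n+1)(log x)^{n+1})` -/

/-- `d/dt (-(((n+1) (log t)^{n+1}))⁻¹) = t⁻¹/(log t)^{n+2}` for `t > 1`. [folklore] -/
theorem hasDerivAt_neg_inv_log_pow {t : ℝ} (ht : 1 < t) (n : ℕ) :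
    HasDerivAt (fun t : ℝ ↦ -(((n : ℝ) + 1) * Real.log t ^ (n + 1))⁻¹)
      (t⁻¹ / Real.log t ^ (n + 2)) t := by
  have ht0 : t ≠ 0 := by positivity
  have hl : 0 < Real.log t := Real.log_pos ht
  have h1 : HasDerivAt (fun t : ℝ ↦ ((n : ℝ) + 1) * Real.log t ^ (n + 1))
      (((n : ℝ) + 1) * (((n + 1 : ℕ) : ℝ) * Real.log t ^ n * t⁻¹)) t :=
    ((Real.hasDerivAt_log ht0).pow (n + 1)).const_mul _
  have hne : ((n : ℝ) + 1) * Real.log t ^ (n + 1) ≠ 0 :=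
    mul_ne_zero (by positivity) (pow_ne_zero _ hl.ne')
  refine ((h1.inv hne).neg).congr_deriv ?_
  push_cast
  field_simp
  ring

/-- `t⁻¹/(log t)^{n+2}` is integrable on `(x, ∞)` for `x > 1`. [folklore] -/
theorem integrableOn_inv_div_log_pow {x : ℝ} (hx : 1 < x) (n : ℕ) :
    IntegrableOn (fun t : ℝ ↦ t⁻¹ / Real.log t ^ (n + 2)) (Ioi x) := by
  have hderiv : ∀ t ∈ Ioi x, HasDerivAt (fun t : ℝ ↦ -(((n : ℝ) + 1) * Real.log t ^ (n + 1))⁻¹)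
      (t⁻¹ / Real.log t ^ (n + 2)) t := fun t ht ↦ hasDerivAt_neg_inv_log_pow (hx.trans ht) n
  have hcont : ContinuousWithinAt (fun t : ℝ ↦ -(((n : ℝ) + 1) * Real.log t ^ (n + 1))⁻¹)
      (Ici x) x :=
    (hasDerivAt_neg_inv_log_pow hx n).continuousAt.continuousWithinAt
  have hlim : Tendsto (fun t : ℝ ↦ -(((n : ℝ) + 1) * Real.log t ^ (n + 1))⁻¹) atTop (𝓝 0) := by
    rw [show (0 : ℝ) = -0 by simp]
    refine Tendsto.neg (tendsto_inv_atTop_zero.comp ?_)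
    refine Tendsto.const_mul_atTop (by positivity) ?_
    exact (tendsto_pow_atTop (by omega)).comp Real.tendsto_log_atTop
  have hnonneg : ∀ t ∈ Ioi x, 0 ≤ t⁻¹ / Real.log t ^ (n + 2) := fun t ht ↦ by
    have h1t : 1 < t := hx.trans ht
    have : 0 < Real.log t := Real.log_pos h1t
    positivity
  exact integrableOn_Ioi_deriv_of_nonneg hcont hderiv hnonneg hlim

/-- `∫_x^∞ dt/(t (log t)^{n+2}) = 1/((n+1)(log x)^{n+1})` for `x > 1`. [folklore] -/
theorem integral_Ioi_inv_div_log_pow {x : ℝ} (hx : 1 < x) (n : ℕ) :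
    ∫ t in Ioi x, t⁻¹ / Real.log t ^ (n + 2) = (((n : ℝ) + 1) * Real.log x ^ (n + 1))⁻¹ := by
  have hderiv : ∀ t ∈ Ioi x, HasDerivAt (fun t : ℝ ↦ -(((n : ℝ) + 1) * Real.log t ^ (n + 1))⁻¹)
      (t⁻¹ / Real.log t ^ (n + 2)) t := fun t ht ↦ hasDerivAt_neg_inv_log_pow (hx.trans ht) n
  have hcont : ContinuousWithinAt (fun t : ℝ ↦ -(((n : ℝ) + 1) * Real.log t ^ (n + 1))⁻¹)
      (Ici x) x :=
    (hasDerivAt_neg_inv_log_pow hx n).continuousAt.continuousWithinAt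
  have hlim : Tendsto (fun t : ℝ ↦ -(((n : ℝ) + 1) * Real.log t ^ (n + 1))⁻¹) atTop (𝓝 0) := by
    rw [show (0 : ℝ) = -0 by simp]
    refine Tendsto.neg (tendsto_inv_atTop_zero.comp ?_)
    refine Tendsto.const_mul_atTop (by positivity) ?_
    exact (tendsto_pow_atTop (by omega)).comp Real.tendsto_log_atTop
  rw [integral_Ioi_of_hasDerivAt_of_tendsto hcont hderiv (integrableOn_inv_div_log_pow hx n) hlim]
  ring

/-- Tail bound: if `|h(t)| ≤ K/(log t)^m` on `(x, ∞)` (`x > 1`, `K ≥ 0`) then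
`|∫_x^∞ h(t) t⁻¹/(log t)^{k+2} dt| ≤ K/(log x)^{m+k+1}` (the exact value of the majorant is
`K/((m+k+1)(log x)^{m+k+1})`). [folklore] -/
theorem abs_integral_Ioi_mul_inv_div_log_pow_le {h : ℝ → ℝ} {x K : ℝ}
    (hx : 1 < x) (m k : ℕ) (hK0 : 0 ≤ K) (hK : ∀ t : ℝ, x < t → |h t| ≤ K / Real.log t ^ m) :
    |∫ t in Ioi x, h t * (t⁻¹ / Real.log t ^ (k + 2))| ≤ K / Real.log x ^ (m + k + 1) := by
  have hlx : 0 < Real.log x := Real.log_pos hx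
  have hwint : IntegrableOn (fun t : ℝ ↦ t⁻¹ / Real.log t ^ (m + k + 2)) (Ioi x) :=
    integrableOn_inv_div_log_pow hx (m + k)
  have hbound : ∀ᵐ t ∂(volume.restrict (Ioi x)),
      ‖h t * (t⁻¹ / Real.log t ^ (k + 2))‖ ≤ K * (t⁻¹ / Real.log t ^ (m + k + 2)) := by
    rw [ae_restrict_iff' measurableSet_Ioi]
    refine Eventually.of_forall fun t ht ↦ ?_
    have hxt : x < t := ht
    have ht0 : 0 < t := by linarith
    have hl : 0 < Real.log t := Real.log_pos (hx.trans hxt)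
    have hw0 : (0 : ℝ) ≤ t⁻¹ / Real.log t ^ (k + 2) := by positivity
    rw [norm_mul, Real.norm_eq_abs, Real.norm_eq_abs, abs_of_nonneg hw0]
    calc |h t| * (t⁻¹ / Real.log t ^ (k + 2))
        ≤ K / Real.log t ^ m * (t⁻¹ / Real.log t ^ (k + 2)) :=
          mul_le_mul_of_nonneg_right (hK t hxt) hw0
      _ = K * (t⁻¹ / Real.log t ^ (m + k + 2)) := by
          have hlne : Real.log t ≠ 0 := hl.ne'
          field_simp
          ring
  calc |∫ t in Ioi x, h t * (t⁻¹ / Real.log t ^ (k + 2))|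
      = ‖∫ t in Ioi x, h t * (t⁻¹ / Real.log t ^ (k + 2))‖ := rfl
    _ ≤ ∫ t in Ioi x, K * (t⁻¹ / Real.log t ^ (m + k + 2)) :=
        norm_integral_le_of_norm_le (hwint.const_mul K) hbound
    _ = K * ((((m + k : ℕ) : ℝ) + 1) * Real.log x ^ (m + k + 1))⁻¹ := by
        rw [integral_const_mul, integral_Ioi_inv_div_log_pow hx (m + k)]
    _ ≤ K * (Real.log x ^ (m + k + 1))⁻¹ := by
        refine mul_le_mul_of_nonneg_left (inv_anti₀ (pow_pos hlx _) ?_) hK0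
        have h0 : (0 : ℝ) ≤ ((m + k : ℕ) : ℝ) := Nat.cast_nonneg _
        calc Real.log x ^ (m + k + 1) = 1 * Real.log x ^ (m + k + 1) := (one_mul _).symm
          _ ≤ (((m + k : ℕ) : ℝ) + 1) * Real.log x ^ (m + k + 1) := by
              gcongr
              linarith
    _ = K / Real.log x ^ (m + k + 1) := (div_eq_mul_inv _ _).symm

/-! ### Partial summation from `ϑ`: Mertens' first theorem with its constant -/

/-- `ϑ` is measurable (a step function of `⌊x⌋₊`). [folklore] -/
theorem measurable_theta : Measurable Chebyshev.theta := by
  have : Chebyshev.theta = (fun n : ℕ ↦ Chebyshev.theta n) ∘ Nat.floor := by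
    funext x; exact Chebyshev.theta_eq_theta_coe_floor x
  rw [this]
  exact (measurable_from_nat (f := fun n : ℕ ↦ Chebyshev.theta n)).comp Nat.measurable_floor

/-- `|ϑ(t) - t| ≤ 3t` for `t ≥ 0` (Chebyshev: `0 ≤ ϑ(t) ≤ (log 4) t`). [folklore] -/
theorem abs_theta_sub_self_le {t : ℝ} (ht : 0 ≤ t) : |θ t - t| ≤ 3 * t := by
  have h1 := Chebyshev.theta_le_log4_mul_x ht
  have h2 := Chebyshev.theta_nonneg t
  have hl4 : Real.log 4 ≤ 4 - 1 := by
    have := Real.add_one_le_exp (3 : ℝ)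
    have h4 : (4 : ℝ) ≤ Real.exp 3 := by
      have := Real.exp_one_gt_d9
      have h3 : Real.exp 3 = Real.exp 1 ^ 3 := by rw [← Real.exp_nat_mul]; norm_num
      rw [h3]; nlinarith
    have := Real.log_le_log (by norm_num) h4
    rw [Real.log_exp] at this
    linarith
  rw [abs_le]
  constructor <;> nlinarith

/-- **Partial summation** (Mathlib's `sum_mul_eq_sub_sub_integral_mul` with `c_p = log p`,
`f(t) = 1/t`): for `x ≥ 2`, `∑_{p ≤ x} log p/p = ϑ(x)/x + ∫_2^x ϑ(t) dt/t²`
(Montgomery–Vaughan, proof of Thm 2.7 (b)). [cite: MontgomeryVaughan2007, Thm 2.7 (b), proof] -/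
theorem primeLogDivSum_eq_theta_add_integral {x : ℝ} (hx : 2 ≤ x) :
    primeLogDivSum x = θ x / x + ∫ t in Ioc 2 x, θ t / t ^ 2 := by
  set c : ℕ → ℝ := fun k => if k.Prime then Real.log k else 0 with hc
  set f : ℝ → ℝ := fun t => t⁻¹ with hf
  have hS : ∀ t : ℝ, ∑ k ∈ Icc 0 ⌊t⌋₊, c k = θ t := fun t ↦ by
    rw [Chebyshev.theta_eq_sum_Icc, Finset.sum_filter]
  have hf_diff : ∀ t ∈ Set.Icc 2 x, DifferentiableAt ℝ f t := fun t ht =>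
    (hasDerivAt_inv (show t ≠ 0 by linarith [ht.1])).differentiableAt
  have hderiv_eq : ∀ t ∈ Set.Icc 2 x, deriv f t = -(t ^ 2)⁻¹ := fun t ht => by
    rw [hf, deriv_inv]
  have hmem : ∀ t ∈ Set.Icc 2 x, t ∈ ({0}ᶜ : Set ℝ) := fun t ht =>
    Set.mem_compl_singleton_iff.mpr (show (0 : ℝ) < t by linarith [ht.1]).ne'
  have hg_cont : ContinuousOn (fun t : ℝ ↦ -(t ^ 2)⁻¹) (Set.Icc 2 x) :=
    ((continuousOn_pow 2 : ContinuousOn (fun t : ℝ ↦ t ^ 2) (Set.Icc 2 x)).inv₀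
      fun t (ht : t ∈ Set.Icc 2 x) => pow_ne_zero _ (show t ≠ 0 by linarith [ht.1])).neg
  have hf_int : IntegrableOn (deriv f) (Set.Icc 2 x) :=
    hg_cont.integrableOn_Icc.congr_fun (fun t ht => (hderiv_eq t ht).symm) measurableSet_Icc
  have habel := sum_mul_eq_sub_sub_integral_mul c (by norm_num : (0 : ℝ) ≤ 2) hx hf_diff hf_int
  have hfl2 : ⌊(2 : ℝ)⌋₊ = 2 := by norm_num
  have hfc : ∀ k : ℕ, f k * c k = if k.Prime then Real.log k / k else 0 := by
    intro k
    simp only [hf, hc]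
    split_ifs with hk
    · rw [div_eq_inv_mul]
    · simp
  have hsum : ∀ n : ℕ, ∑ k ∈ Ioc 0 n, f k * c k = ∑ p ∈ Nat.primesLE n, Real.log p / p := by
    intro n
    rw [Nat.primesLE_eq_filter_Ioc_zero, Finset.sum_filter]
    exact Finset.sum_congr rfl fun k _ ↦ hfc k
  have hx2 : 2 ≤ ⌊x⌋₊ := Nat.le_floor (by simpa using hx)
  have hlhs : ∑ k ∈ Ioc ⌊(2 : ℝ)⌋₊ ⌊x⌋₊, f k * c k = primeLogDivSum x - Real.log 2 / 2 := by
    rw [hfl2, primeLogDivSum, ← hsum, eq_sub_iff_add_eq, add_comm,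
      Finset.sum_Ioc_consecutive _ (Nat.zero_le 2) hx2 |>.symm]
    congr 1
    rw [show Finset.Ioc 0 2 = {1, 2} by decide, Finset.sum_pair (by norm_num), hfc, hfc]
    norm_num [Nat.prime_two, Nat.not_prime_one]
  have hb2 : f 2 * ∑ k ∈ Icc 0 ⌊(2 : ℝ)⌋₊, c k = Real.log 2 / 2 := by
    rw [hS, hf]
    have : θ (2 : ℝ) = Real.log 2 := by
      rw [show (2 : ℝ) = ((2 : ℕ) : ℝ) by norm_num, Chebyshev.theta_eq_sum_primesLE_log,
        primesLE_two, Finset.sum_singleton]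
    rw [this]
    ring
  have hbx : f x * ∑ k ∈ Icc 0 ⌊x⌋₊, c k = θ x / x := by
    rw [hS, hf]
    ring
  have hint : ∫ t in Set.Ioc 2 x, deriv f t * ∑ k ∈ Icc 0 ⌊t⌋₊, c k =
      -∫ t in Ioc 2 x, θ t / t ^ 2 := by
    rw [← integral_neg]
    refine setIntegral_congr_fun measurableSet_Ioc fun t ht ↦ ?_
    rw [hderiv_eq t (Set.Ioc_subset_Icc_self ht), hS]
    ring
  rw [hlhs, hb2, hbx, hint] at habel
  linarith

/-- `(ϑ(t) - t)/t²` is integrable on every `(2, x]` (bounded by `3/2`, measurable). [folklore] -/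
theorem integrableOn_theta_sub_div_sq_Ioc (x : ℝ) :
    IntegrableOn (fun t : ℝ ↦ (θ t - t) / t ^ 2) (Ioc 2 x) := by
  have hmeas : Measurable fun t : ℝ ↦ (θ t - t) / t ^ 2 :=
    (measurable_theta.sub measurable_id).div (measurable_id.pow_const 2)
  refine Integrable.mono' (g := fun _ ↦ (3 / 2 : ℝ)) (integrableOn_const (by simp))
    hmeas.aestronglyMeasurable ?_
  rw [ae_restrict_iff' measurableSet_Ioc]
  refine Eventually.of_forall fun t ht ↦ ?_
  have ht2 : (2 : ℝ) < t := ht.1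
  have ht0 : 0 < t := by linarith
  rw [Real.norm_eq_abs, abs_div, abs_of_pos (by positivity : (0 : ℝ) < t ^ 2), div_le_iff₀
    (by positivity)]
  have := abs_theta_sub_self_le ht0.le
  nlinarith

/-- **`τ(x) = 1 - log 2 + (ϑ(x) - x)/x + ∫_2^x (ϑ(t) - t) dt/t²`** for `x ≥ 2`
(`τ(x) = ∑_{p ≤ x} log p/p - log x`, `mertensTau`): subtract `∫_2^x dt/t = log x - log 2` from the
partial summation formula. [cite: MontgomeryVaughan2007, Thm 2.7 (b), proof] -/
theorem mertensTau_eq {x : ℝ} (hx : 2 ≤ x) :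
    mertensTau x = 1 - Real.log 2 + (θ x - x) / x + ∫ t in Ioc 2 x, (θ t - t) / t ^ 2 := by
  rw [mertensTau, primeLogDivSum_eq_theta_add_integral hx]
  have hx0 : 0 < x := by linarith
  have h1 : IntegrableOn (fun t : ℝ ↦ t⁻¹) (Ioc 2 x) := by
    refine ((continuousOn_inv₀ (G₀ := ℝ)).mono ?_).integrableOn_Icc.mono_set Set.Ioc_subset_Icc_self
    intro t ht
    exact Set.mem_compl_singleton_iff.mpr (show (0 : ℝ) < t by linarith [ht.1]).ne'
  have hsplit : ∀ t ∈ Ioc 2 x, θ t / t ^ 2 = (θ t - t) / t ^ 2 + t⁻¹ := by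
    intro t ht
    have ht0 : t ≠ 0 := by linarith [ht.1]
    field_simp
    ring
  rw [setIntegral_congr_fun measurableSet_Ioc hsplit,
    integral_add (integrableOn_theta_sub_div_sq_Ioc x) h1]
  have hinv : ∫ t in Ioc 2 x, t⁻¹ = Real.log x - Real.log 2 := by
    rw [← intervalIntegral.integral_of_le hx, integral_inv (by
      rw [Set.uIcc_of_le hx]; intro h0; exact absurd h0.1 (by norm_num)),
      Real.log_div (by linarith) (by norm_num)]
  rw [hinv]
  field_simp
  ring

/-- From the prime number theorem with error term (PROVED in the tree,
`ChebyshevThetaDeLaValleePoussin_holds.logPow`): for every `n` there is `C ≥ 0` with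
`|ϑ(x) - x| ≤ C x/(log x)^n` for `x ≥ 2`. [cite: MontgomeryVaughan2007, Theorem 6.9 (6.13)] -/
theorem exists_abs_theta_sub_le_div_log_pow (n : ℕ) :
    ∃ C : ℝ, 0 ≤ C ∧ ∀ x : ℝ, 2 ≤ x → |θ x - x| ≤ C * x / Real.log x ^ n := by
  obtain ⟨C, hC⟩ := ChebyshevThetaDeLaValleePoussin_holds.logPow (n : ℝ)
  have hC' : ∀ x : ℝ, 2 ≤ x → |θ x - x| ≤ C * x / Real.log x ^ n := fun x hx ↦ by
    have := hC x hx
    rwa [Real.rpow_natCast] at this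
  refine ⟨C, ?_, hC'⟩
  have h2 := hC' 2 le_rfl
  have hl : 0 < Real.log 2 := Real.log_pos one_lt_two
  have h0 : 0 ≤ C * 2 / Real.log 2 ^ n := (abs_nonneg _).trans h2
  have : 0 ≤ C * 2 := by
    by_contra hneg
    have : C * 2 / Real.log 2 ^ n < 0 := div_neg_of_neg_of_pos (not_le.mp hneg) (pow_pos hl n)
    linarith
  linarith

/-- `(ϑ(t) - t)/t²` is integrable on `(2, ∞)`: it is `O(1/(t log² t))` by the prime number
theorem. [folklore] -/
theorem integrableOn_theta_sub_div_sq : IntegrableOn (fun t : ℝ ↦ (θ t - t) / t ^ 2) (Ioi 2) := by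
  obtain ⟨C, hC0, hC⟩ := exists_abs_theta_sub_le_div_log_pow 2
  have hmeas : Measurable fun t : ℝ ↦ (θ t - t) / t ^ 2 :=
    (measurable_theta.sub measurable_id).div (measurable_id.pow_const 2)
  refine Integrable.mono' (integrableOn_inv_div_log_sq.const_mul C) hmeas.aestronglyMeasurable ?_
  rw [ae_restrict_iff' measurableSet_Ioi]
  refine Eventually.of_forall fun t ht ↦ ?_
  have ht2 : (2 : ℝ) < t := ht
  have ht0 : 0 < t := by linarith
  have hl : 0 < Real.log t := Real.log_pos (by linarith)
  rw [Real.norm_eq_abs, abs_div, abs_of_pos (by positivity : (0 : ℝ) < t ^ 2), div_le_iff₀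
    (by positivity)]
  calc |θ t - t| ≤ C * t / Real.log t ^ 2 := hC t ht2.le
    _ = C * (t⁻¹ / Real.log t ^ 2) * t ^ 2 := by field_simp

/-- For `x ≥ 2`: `τ(x) - E = (ϑ(x) - x)/x - ∫_x^∞ (ϑ(t) - t) dt/t²`, where
`E = 1 - log 2 + ∫_2^∞ (ϑ(t) - t) dt/t²` is the constant of Mertens' first theorem
`∑_{p ≤ x} log p/p = log x + E + o(1)` (classically `E = -γ - ∑_p log p/(p(p-1))`,
Montgomery–Vaughan Thm 2.7 (b) / §6.2, an identification not needed here). [folklore] -/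
theorem mertensTau_sub_const_eq {x : ℝ} (hx : 2 ≤ x) :
    mertensTau x - (1 - Real.log 2 + ∫ t in Ioi 2, (θ t - t) / t ^ 2) =
      (θ x - x) / x - ∫ t in Ioi x, (θ t - t) / t ^ 2 := by
  have hI := integrableOn_theta_sub_div_sq
  have hsplit : ∫ t in Ioi 2, (θ t - t) / t ^ 2 =
      (∫ t in Ioc 2 x, (θ t - t) / t ^ 2) + ∫ t in Ioi x, (θ t - t) / t ^ 2 := by
    rw [← setIntegral_union (Set.Ioc_disjoint_Ioi le_rfl) measurableSet_Ioi
      (hI.mono_set Ioc_subset_Ioi_self) (hI.mono_set (Ioi_subset_Ioi hx)),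
      Ioc_union_Ioi_eq_Ioi hx]
  rw [hsplit, mertensTau_eq hx]
  ring

/-- **Mertens' first theorem with its constant and a log-power error term**: for every `n` there
is `K` with `|∑_{p ≤ x} log p/p - log x - E| ≤ K/(log x)^n` for all `x ≥ 2` — from
`|ϑ(x) - x| ≤ C x/(log x)^{n+1}` by partial summation (Montgomery–Vaughan §6.2: Thm 2.7 (b) with
the error term of Thm 6.9). [cite: MontgomeryVaughan2007, Thm 2.7 (b) and §6.2] -/
theorem abs_mertensTau_sub_const_le (n : ℕ) :
    ∃ K : ℝ, ∀ x : ℝ, 2 ≤ x →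
      |mertensTau x - (1 - Real.log 2 + ∫ t in Ioi 2, (θ t - t) / t ^ 2)| ≤ K / Real.log x ^ n := by
  obtain ⟨C, hC0, hC⟩ := exists_abs_theta_sub_le_div_log_pow (n + 2)
  have hl2 : 0 < Real.log 2 := Real.log_pos one_lt_two
  refine ⟨C / Real.log 2 ^ 2 + C / Real.log 2, fun x hx ↦ ?_⟩
  have hx1 : 1 < x := by linarith
  have hx0 : 0 < x := by linarith
  have hl : 0 < Real.log x := Real.log_pos hx1
  have hl2x : Real.log 2 ≤ Real.log x := Real.log_le_log two_pos hx
  rw [mertensTau_sub_const_eq hx]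
  -- the boundary term
  have h1 : |(θ x - x) / x| ≤ C / Real.log 2 ^ 2 / Real.log x ^ n := by
    rw [abs_div, abs_of_pos hx0, div_le_iff₀ hx0]
    calc |θ x - x| ≤ C * x / Real.log x ^ (n + 2) := hC x hx
      _ = C / Real.log x ^ 2 / Real.log x ^ n * x := by
          have hlne : Real.log x ≠ 0 := hl.ne'
          field_simp
          ring
      _ ≤ C / Real.log 2 ^ 2 / Real.log x ^ n * x := by gcongr
  -- the tail integral
  have h2 : |∫ t in Ioi x, (θ t - t) / t ^ 2| ≤ C / Real.log x ^ (n + 1) := by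
    have hwint : IntegrableOn (fun t : ℝ ↦ t⁻¹ / Real.log t ^ (n + 2)) (Ioi x) :=
      integrableOn_inv_div_log_pow hx1 n
    have hbound : ∀ᵐ t ∂(volume.restrict (Ioi x)),
        ‖(θ t - t) / t ^ 2‖ ≤ C * (t⁻¹ / Real.log t ^ (n + 2)) := by
      rw [ae_restrict_iff' measurableSet_Ioi]
      refine Eventually.of_forall fun t ht ↦ ?_
      have hxt : x < t := ht
      have ht0 : 0 < t := by linarith
      have hlt : 0 < Real.log t := Real.log_pos (hx1.trans hxt)
      rw [Real.norm_eq_abs, abs_div, abs_of_pos (by positivity : (0 : ℝ) < t ^ 2),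
        div_le_iff₀ (by positivity)]
      calc |θ t - t| ≤ C * t / Real.log t ^ (n + 2) := hC t (by linarith)
        _ = C * (t⁻¹ / Real.log t ^ (n + 2)) * t ^ 2 := by
            have hlne : Real.log t ≠ 0 := hlt.ne'
            field_simp
    calc |∫ t in Ioi x, (θ t - t) / t ^ 2|
        = ‖∫ t in Ioi x, (θ t - t) / t ^ 2‖ := rfl
      _ ≤ ∫ t in Ioi x, C * (t⁻¹ / Real.log t ^ (n + 2)) :=
          norm_integral_le_of_norm_le (hwint.const_mul C) hbound
      _ = C * ((((n : ℝ) + 1) * Real.log x ^ (n + 1))⁻¹) := by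
          rw [integral_const_mul, integral_Ioi_inv_div_log_pow hx1 n]
      _ ≤ C * (Real.log x ^ (n + 1))⁻¹ := by
          refine mul_le_mul_of_nonneg_left (inv_anti₀ (pow_pos hl _) ?_) hC0
          have h0 : (0 : ℝ) ≤ (n : ℝ) := Nat.cast_nonneg _
          calc Real.log x ^ (n + 1) = 1 * Real.log x ^ (n + 1) := (one_mul _).symm
            _ ≤ ((n : ℝ) + 1) * Real.log x ^ (n + 1) := by
                gcongr
                linarith
      _ = C / Real.log x ^ (n + 1) := (div_eq_mul_inv _ _).symm
  have h2' : C / Real.log x ^ (n + 1) ≤ C / Real.log 2 / Real.log x ^ n := by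
    rw [pow_succ, div_div, mul_comm]
    exact div_le_div_of_nonneg_left hC0 (by positivity) (by gcongr)
  calc |(θ x - x) / x - ∫ t in Ioi x, (θ t - t) / t ^ 2|
      ≤ |(θ x - x) / x| + |∫ t in Ioi x, (θ t - t) / t ^ 2| := abs_sub _ _
    _ ≤ C / Real.log 2 ^ 2 / Real.log x ^ n + C / Real.log 2 / Real.log x ^ n := by
        linarith [h1, h2, h2']
    _ = (C / Real.log 2 ^ 2 + C / Real.log 2) / Real.log x ^ n := by ring

/-! ### Mertens' second theorem with a log-power error term -/

/-- The exact formula behind Mertens' second theorem (Hardy–Wright (22.7.3) and the integral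
formula for `B₁`, as in `abs_primeRecipSum_sub_le`), recentred at an arbitrary constant `E`: for `x ≥ 2`,
`∑_{p ≤ x} 1/p - log log x - B₁ = (τ(x) - E)/log x - ∫_x^∞ (τ(t) - E) dt/(t log² t)`
(using `∫_x^∞ dt/(t log² t) = 1/log x`). [cite: HardyWright2008, §22.7 eq. (22.7.3)] -/
theorem primeRecipSum_sub_loglog_sub_eq {x : ℝ} (hx : 2 ≤ x) (E : ℝ) :
    primeRecipSum x - Real.log (Real.log x) - meisselMertens =
      (mertensTau x - E) / Real.log x -
        ∫ t in Ioi x, (mertensTau t - E) * (t⁻¹ / Real.log t ^ 2) := by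
  have hlog : 0 < Real.log x := Real.log_pos (by linarith)
  have hI : IntegrableOn (fun t ↦ mertensTau t * (t⁻¹ / Real.log t ^ 2)) (Ioi 2) :=
    integrableOn_mertensTau_mul
  have hsplit : ∫ t in Ioi 2, mertensTau t * (t⁻¹ / Real.log t ^ 2) =
      (∫ t in Ioc 2 x, mertensTau t * (t⁻¹ / Real.log t ^ 2)) +
        ∫ t in Ioi x, mertensTau t * (t⁻¹ / Real.log t ^ 2) := by
    rw [← setIntegral_union (Set.Ioc_disjoint_Ioi le_rfl) measurableSet_Ioi
      (hI.mono_set Ioc_subset_Ioi_self) (hI.mono_set (Ioi_subset_Ioi hx)),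
      Ioc_union_Ioi_eq_Ioi hx]
  have hdiff : primeRecipSum x - Real.log (Real.log x) - meisselMertens =
      mertensTau x / Real.log x - ∫ t in Ioi x, mertensTau t * (t⁻¹ / Real.log t ^ 2) := by
    rw [meisselMertens_eq_integral, primeRecipSum_eq_add_integral hx, integral_primeLogDivSum_mul hx,
      show primeLogDivSum x = Real.log x + mertensTau x by rw [mertensTau]; ring, hsplit]
    set I₁ := ∫ t in Ioc 2 x, mertensTau t * (t⁻¹ / Real.log t ^ 2)
    set I₂ := ∫ t in Ioi x, mertensTau t * (t⁻¹ / Real.log t ^ 2)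
    field_simp
    ring
  rw [hdiff]
  have hwint : IntegrableOn (fun t : ℝ ↦ t⁻¹ / Real.log t ^ 2) (Ioi x) :=
    integrableOn_inv_div_log_sq.mono_set (Ioi_subset_Ioi hx)
  have hsub : ∫ t in Ioi x, (mertensTau t - E) * (t⁻¹ / Real.log t ^ 2) =
      (∫ t in Ioi x, mertensTau t * (t⁻¹ / Real.log t ^ 2)) - E * (Real.log x)⁻¹ := by
    have : (fun t ↦ (mertensTau t - E) * (t⁻¹ / Real.log t ^ 2)) =
        fun t ↦ mertensTau t * (t⁻¹ / Real.log t ^ 2) - E * (t⁻¹ / Real.log t ^ 2) := by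
      funext t; ring
    rw [this, integral_sub (hI.mono_set (Ioi_subset_Ioi hx)) (hwint.const_mul _),
      integral_const_mul, integral_Ioi_inv_div_log_sq hx]
  rw [hsub]
  field_simp
  ring

/-- **Mertens' second theorem with a log-power error term**: for every `n` there is `K` with
`|∑_{p ≤ x} 1/p - log log x - B₁| ≤ K/(log x)^n` for all `x ≥ 2`, `B₁` the Meissel–Mertens
constant (Montgomery–Vaughan §6.2: Thm 2.7 (d) with the error term of Thm 6.9).
[cite: MontgomeryVaughan2007, Thm 2.7 (d) and §6.2] -/
theorem abs_primeRecipSum_sub_loglog_sub_le (n : ℕ) :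
    ∃ K : ℝ, ∀ x : ℝ, 2 ≤ x →
      |primeRecipSum x - Real.log (Real.log x) - meisselMertens| ≤ K / Real.log x ^ n := by
  obtain ⟨K, hK⟩ := abs_mertensTau_sub_const_le n
  set E : ℝ := 1 - Real.log 2 + ∫ t in Ioi 2, (θ t - t) / t ^ 2 with hE
  have hl2 : 0 < Real.log 2 := Real.log_pos one_lt_two
  have hK0 : 0 ≤ K := by
    have h := hK 2 le_rfl
    have : 0 ≤ K / Real.log 2 ^ n := (abs_nonneg _).trans h
    by_contra hneg
    have : K / Real.log 2 ^ n < 0 := div_neg_of_neg_of_pos (not_le.mp hneg) (pow_pos hl2 n)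
    linarith
  refine ⟨K / Real.log 2 + K / Real.log 2, fun x hx ↦ ?_⟩
  have hx1 : 1 < x := by linarith
  have hl : 0 < Real.log x := Real.log_pos hx1
  have hl2x : Real.log 2 ≤ Real.log x := Real.log_le_log two_pos hx
  rw [primeRecipSum_sub_loglog_sub_eq hx E]
  have h1 : |(mertensTau x - E) / Real.log x| ≤ K / Real.log 2 / Real.log x ^ n := by
    rw [abs_div, abs_of_pos hl]
    calc |mertensTau x - E| / Real.log x ≤ K / Real.log x ^ n / Real.log x :=
          div_le_div_of_nonneg_right (hK x hx) hl.le
      _ ≤ K / Real.log x ^ n / Real.log 2 :=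
          div_le_div_of_nonneg_left (div_nonneg hK0 (pow_nonneg hl.le n)) hl2 hl2x
      _ = K / Real.log 2 / Real.log x ^ n := by ring
  have h2 : |∫ t in Ioi x, (mertensTau t - E) * (t⁻¹ / Real.log t ^ 2)| ≤
      K / Real.log 2 / Real.log x ^ n := by
    have h := abs_integral_Ioi_mul_inv_div_log_pow_le hx1 n 0 hK0 fun t ht ↦ hK t (by linarith)
    refine h.trans ?_
    rw [Nat.add_zero, pow_succ, div_div, mul_comm]
    exact div_le_div_of_nonneg_left hK0 (by positivity) (by gcongr)
  calc |(mertensTau x - E) / Real.log x -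
        ∫ t in Ioi x, (mertensTau t - E) * (t⁻¹ / Real.log t ^ 2)|
      ≤ |(mertensTau x - E) / Real.log x| +
        |∫ t in Ioi x, (mertensTau t - E) * (t⁻¹ / Real.log t ^ 2)| := abs_sub _ _
    _ ≤ K / Real.log 2 / Real.log x ^ n + K / Real.log 2 / Real.log x ^ n := add_le_add h1 h2
    _ = (K / Real.log 2 + K / Real.log 2) / Real.log x ^ n := by ring

/-- The same with the sum written out: for every `n` there are `K` and the constant `B₁` with
`|∑_{p ≤ x} 1/p - (log log x + B₁)| ≤ K/(log x)^n` (`x ≥ 2`). [cite: MontgomeryVaughan2007, Thm 2.7 (d) and §6.2] -/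
theorem abs_sum_primesLE_inv_sub_loglog_le (n : ℕ) :
    ∃ K : ℝ, ∀ x : ℝ, 2 ≤ x →
      |(∑ p ∈ Nat.primesLE ⌊x⌋₊, (p : ℝ)⁻¹) - (Real.log (Real.log x) + meisselMertens)| ≤
        K / Real.log x ^ n := by
  obtain ⟨K, hK⟩ := abs_primeRecipSum_sub_loglog_sub_le n
  refine ⟨K, fun x hx ↦ ?_⟩
  have := hK x hx
  rw [primeRecipSum] at this
  rwa [← sub_sub]

/-- **Hypothesis (1.9) of Friedlander–Iwaniec for the density `f(p) = 1/p`**: there are `c`, `K`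
with `|∑_{p ≤ y} 1/p - (log log y + c)| ≤ K/(log y)^{10}` for all `y ≥ 2` ("`f` is another
multiplicative function which satisfies the hypothesis (1.9)", FI p. 1049, with `f(n) = n⁻¹`).
[cite: FriedlanderIwaniecASP1998, (1.9) and p. 1049] -/
theorem exists_sum_primesLE_inv_loglog :
    ∃ c K : ℝ, ∀ y : ℝ, 2 ≤ y →
      |(∑ p ∈ Nat.primesLE ⌊y⌋₊, (p : ℝ)⁻¹) - (Real.log (Real.log y) + c)| ≤
        K / Real.log y ^ 10 := by
  obtain ⟨K, hK⟩ := abs_sum_primesLE_inv_sub_loglog_le 10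
  exact ⟨meisselMertens, K, hK⟩

end Literature.NumberTheory.LFunctions.Mertens
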